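import Literature.NumberTheory.LFunctions.LiouvilleSieve

/-!
# Certified computation of `L(x) = ∑_{n ≤ x} λ(n)`, block 00: segments `0 ≤ s < 36`

One compiled evaluation (`native_decide`) of
`Literature.RH.LiouvilleSieve.checkChunk 0 36 (0) (-1551)`; see
`Literature/NumberTheory/LFunctions/LiouvilleSieve.lean` for the algorithm, for its
correctness statement `checkChunk_spec`, and for the meaning of the arguments. In words: from
`L(0·Q - 1) = 0` (`Q = 1058400`), the summatory Liouville function satisfies `L(n) ≤ 0`
for all `0 ≤ n < 38102400` (`n ≥ 2`), and `L(38102400 - 1) = -1551`.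
The boundary values come from an independent sieve (C, this project) and agree with Tanaka's
table [Tanaka1980, p. 188] at the multiples of `10⁸`. The only non-standard axiom of this file
is the `native_decide` auxiliary axiom of `checkChunk_00` (trust in the Lean compiler, the
`Lean.ofReduceBool` / `Lean.trustCompiler` family), declared to the gate as `computational`.
-/

namespace Literature.NumberTheory.LFunctions.LiouvilleSieve

/-- Block 00 of the certified computation behind Tanaka's result (smallest counterexample to
Pólya's conjecture): `checkChunk 0 36 (0) (-1551) = true`, i.e. `L(n) ≤ 0` for
`0 ≤ n < 38102400` (`n ≥ 2`) and `L(38102399) = -1551`, given `L(0 - 1) = 0`.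
[cite: Tanaka1980, pp. 187–188] -/
theorem checkChunk_00 : checkChunk 0 36 (0) (-1551) = true := by
  native_decide

end Literature.NumberTheory.LFunctions.LiouvilleSieve
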